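import Summits.BirchSwinnertonDyer.Rank1Residual.X11b.Three.CornerSplitResidual
import Summits.BirchSwinnertonDyer.Rank1Residual.X11b.Three.OpenInputTight
import HarnessLib

/-!
# Class X11b at `p = 3` (team N8/O2 = cell `b2b-bsdres`, seat x11b3-p8, lead deal #6 (R6-2)): the
# GZ-currency hull `CornerSplitResidualAt` versus the three inputs of record — the converse bridge

HONEST FRAMING (verbatim, cell `b2b-bsdres`, run/shared/lean/b2b/bsd-rank1-residual/): the goal of
the cell is to DELETE the COMBINATION-SHAPED residual classes for ALL analytic-rank `≤ 1` curves
over `ℚ` — "full BSD formula for every rank `≤ 1` curve in class `C`" assembled STRICTLY from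
published theorems — so that the rank-`≤ 1` remainder becomes exactly the CONSTRUCTION-SHAPED
classes, which are TYPED (missing-input Props), NOT attempted; this is not "finishing BSD".
Research route; nothing booked; NO label changes. THEOREMS ONLY (no definition, no named fact, no
`sorry`).

## What this file does (lead deal #6 (R6-2): "KEEP `CornerSplitResidualAt` as the split corner's
## TIGHT HULL, conditional on ONE bridge relating it to (L) ∧ (Tw) ∧ (U♯)")

Inputs of record on the (T4″)@3 corner (`CornerResidual.lean`, p253638): (L) `CornerStepLAt W` (S0
currency: `IMCLowerWaldspurgerOnTreeAt`), (Tw) `CornerTwistAt W` (`BSDp` of the odd Heegner twists),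
(U♯) `CornerUpperAt W` (Tamagawa-sharp `K`-bound). Hull (`CornerSplitResidualDefs.lean`, p253172):
`CornerSplitResidualAt W` = at every odd Heegner datum of a split-corner pair, `IndexLowerBoundAt`
(GZ currency) ∧ the sharp `K`-bound ∧ `PPartRankZero` of the twist. Direction inputs ⇒ hull is
`cornerSplitResidualAt_of_cornerInputs` (`CornerSplitResidual.lean` §3, p254008). This file is the
CONVERSE, conjunct by conjunct, on `ClassX11b W 3 ∧ ¬ Surj W 3 ∧ split(3)`:
* `cornerUpperAt_of_cornerSplitResidualAt` — hull ⇒ (U♯): UNCONDITIONAL (same currency; a globally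
  minimal twist model exists by Néron to instantiate the hull).
* `cornerTwistAt_of_cornerSplitResidualAt` — hull ⇒ (Tw): modulo PUBLISHED facts only (a Manin-good
  datum for the given `K` by `exists_maninDatum_of_odd`; `P ∉ E(K)_tors`, `Ш(E/K)` finite by
  Gross–Zagier + Kolyvagin; `PPartRankZero ⇒ BSDp` by `bsdp_of_pPartRankZero`).
* `cornerStepLAt_of_cornerSplitResidualAt_of_control` — hull ⇒ (L): the currencies GENUINELY DIFFER
  (GZ vs S0); the passage needs the anticyclotomic CONTROL IDENTITY `ControlOnTreeAt 3 κ 𝔭 γ embAt P`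
  (Castella 2018 Thm. 2.3 / JSW17 Thm. 3.3.1 SHAPE) at the corner's data — in the tree a THEOREM only
  on (ram) ∧ `3 ∤ ∏c` ∧ locally-trivial pairs (`controlOnTreeAt_heegner_odd_of_facts`), NOT on the
  corner (`¬Ram`, `3 ∣ c₃`): carried as the labelled hypothesis `hCTL`, exactly as in x11b3-p7's
  tightness `P2.openInputOnTreeOddAt_iff_bsdp_of_locus` (used ONLY in the direction hull ⇒ input).
* `cornerSplitResidualAt_iff_cornerInputs_of_control` — the requested `iff`, modulo `hCTL` and PUB.
So the hull is an input-of-record substitute for (Tw) ∧ (U♯) and, GIVEN CONTROL, for (L); without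
control it is strictly on the Gross–Zagier side of (L). CONDITIONAL; nothing booked; O2 OPEN.

References: [Castella2018] Thm. 2.3 (shape); [JetchevSkinnerWan2017] Thm. 3.3.1, §7.4.1; [GrossLMS1991]
(2.2); [Miller2011LMS] Def. 1.1; OWNERS.md deal #6 (R6-2).
-/

noncomputable section

open scoped Classical

open WeierstrassCurve NumberField IsDedekindDomain Field Literature.NumberTheory.EllipticCurves
  Rat.HeightOneSpectrum
  Literature.NumberTheory.DiophantineGeometry
  Literature.NumberTheory.EllipticCurves.GreenbergSelmer
  Literature.NumberTheory.EllipticCurves.ModularForms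
  Literature.NumberTheory.EllipticCurves.Rank1Residual
  Literature.NumberTheory.EllipticCurves.Rank1Residual.Typed
  Literature.NumberTheory.EllipticCurves.Wuthrich2014
  Literature.NumberTheory.EllipticCurves.BalakrishnanEtAl2019
  Literature.NumberTheory.EllipticCurves.Skinner2016
  Literature.NumberTheory.QuadraticFields.Quadratic
  Literature.NumberTheory.Automorphic
  Literature.NumberTheory.GaloisRepresentations Literature.NumberTheory.GaloisCohomology
  Summit.BirchSwinnertonDyer.Rank1Residual.X11b.AcSelmer
  Summit.BirchSwinnertonDyer.Rank1Residual.X11b.LocBridge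

namespace Summit.BirchSwinnertonDyer.Rank1Residual.X11b.Three

/-- **Hull ⇒ (U♯)**, unconditionally: on a split-corner pair, `CornerSplitResidualAt W → CornerUpperAt W`
(instantiate the hull at the given datum with a globally minimal model of the twist, which exists by
Néron — `hasGlobalMinimalModel_rat_holds`; read off the second conjunct). [folklore] -/
theorem cornerUpperAt_of_cornerSplitResidualAt [Fact (Nat.Prime 3)] (W : WeierstrassCurve ℚ)
    [W.IsElliptic] [W.IsGloballyMinimal] (hs : W.HasSplitMultiplicativeReductionAtPrime 3)
    (hR : CornerSplitResidualAt W) : CornerUpperAt W := by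
  intro N _ K _ _ Dt H ι P hX hns _ht hN hK hodd hHN hLt hP hc hPinf hfin
  have hD0 : (NumberField.discr K : ℚ) ≠ 0 := by exact_mod_cast NumberField.discr_ne_zero K
  haveI hEt : (W.quadraticTwist (NumberField.discr K : ℚ)).IsElliptic :=
    W.isElliptic_quadraticTwist hD0
  obtain ⟨Cd, hCd⟩ := hasGlobalMinimalModel_rat_holds (W.quadraticTwist (NumberField.discr K : ℚ))
  haveI := hCd
  exact (hR hX hns hs N K Dt H ι P (Cd • W.quadraticTwist (NumberField.discr K : ℚ)) Cd hN hK hodd hHN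
    hLt hP hc hPinf hfin rfl).2.1

/-- **Hull ⇒ (Tw)**, modulo PUBLISHED facts: on a split-corner pair, `CornerSplitResidualAt W →
CornerTwistAt W`. For a given odd Heegner `K` and minimal twist model `Wd`: a Manin-good datum
`(Dt, H, ι, P)` with `3 ∤ c` exists (`exists_maninDatum_of_odd`: newform `hnf`, Mazur 1978 Cor. 4.1
`hMaz`, Néron scaling a theorem), `P ∉ E(K)_tors` (Gross–Zagier `hGZ`, modularity `hmod`) and
`Ш(E/K)` is finite (Kolyvagin `hKo`); the hull's third conjunct is `PPartRankZero Wd 3`, which is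
`BSDp Wd 3` in analytic rank `0` (`bsdp_of_pPartRankZero`, GZK `hGZK`).
[cite: Mazur1978, Cor. 4.1] [cite: Miller2011LMS, §1 and Def. 1.1] -/
theorem cornerTwistAt_of_cornerSplitResidualAt [Fact (Nat.Prime 3)]
    (hGZ : ∀ (N : ℕ) [NeZero N] (W : WeierstrassCurve ℚ) (K : Type) [Field K] [NumberField K],
      gross_zagier N W K)
    (hKo : ∀ (N : ℕ) [NeZero N] (W : WeierstrassCurve ℚ) (K : Type) [Field K] [NumberField K],
      kolyvagin N W K)
    (hGZK : rank_eq_analyticRank_of_analyticRank_le_one) (hmod : hasEntireLFunction_rat)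
    (hnf : exists_isNewformOf) (hMaz : mazur_not_dvd_maninConstant_of_odd)
    (W : WeierstrassCurve ℚ) [W.IsElliptic] [W.IsGloballyMinimal]
    (hs : W.HasSplitMultiplicativeReductionAtPrime 3) (hR : CornerSplitResidualAt W) :
    CornerTwistAt W := by
  intro K _ _ Wd _ _ Cd hX hns hK hodd hHN hLt hWd
  have hNS : integral_neronScaling_of_isGloballyMinimal :=
    integral_neronScaling_of_isGloballyMinimal_holds
  obtain ⟨hr, hp2, hmult, hirr⟩ := id hX
  haveI : NeZero (W.conductorNorm ℤ) := ⟨(W.conductorNorm_pos_holds).ne'⟩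
  obtain ⟨Dt, H, ι, P, hP, hc⟩ :=
    exists_maninDatum_of_odd hnf hMaz hNS W 3 (W.conductorNorm ℤ) K rfl hp2 hmult hirr hK hHN
  have hPinf : ¬ IsOfFinAddOrder P :=
    not_isOfFinAddOrder_of_heegner_of_analyticRank_eq_one W _ K Dt H ι P (hGZ _ W K) hmod hr hK hHN
      hLt hP
  have hfinK : Finite (W.baseChange K).sha :=
    finite_sha_baseChange_of_heegner W _ K Dt H ι P (hGZ _ W K) (hKo _ W K) hmod hr hK hHN hLt hP
  obtain ⟨-, -, htw⟩ :=
    hR hX hns hs (W.conductorNorm ℤ) K Dt H ι P Wd Cd rfl hK hodd hHN hLt hP hc hPinf hfinK hWd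
  have hD0 : (NumberField.discr K : ℚ) ≠ 0 := by exact_mod_cast NumberField.discr_ne_zero K
  haveI hEt : (W.quadraticTwist (NumberField.discr K : ℚ)).IsElliptic :=
    W.isElliptic_quadraticTwist hD0
  have hLt' : (W.quadraticTwist (NumberField.discr K : ℚ)).entireLFunction = Wd.entireLFunction := by
    rw [← hWd, entireLFunction_smul]
  have hLd1 : Wd.entireLFunction 1 ≠ 0 := by rw [← hLt']; exact hLt
  have hrd : Wd.analyticRank = 0 := (Wd.analyticRank_eq_zero_iff_holds (hmod Wd)).2 hLd1
  exact bsdp_of_pPartRankZero Wd 3 hmod hGZK hrd htw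

/-- **Hull ⇒ (L), GIVEN THE CONTROL IDENTITY** (the currencies differ: GZ vs S0). On a split-corner
pair, `CornerSplitResidualAt W → CornerStepLAt W` modulo `hCTL : ControlOnTreeAt 3 κ 𝔭 γ embAt P`
at every odd Manin-good Heegner datum and every anticyclotomic `(κ, γ, 𝔭)` — Castella 2018 Thm. 2.3 /
JSW17 Thm. 3.3.1 as an IDENTITY on the constructed `X_ac` [a tree THEOREM only on (ram) ∧ `3 ∤ ∏c` ∧
locally-trivial pairs, `controlOnTreeAt_heegner_odd_of_facts`; on the corner (`¬Ram`, `3 ∣ c₃`) it is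
a LABELLED HYPOTHESIS, shape only, nothing asserted]: instantiate the hull (twist model by Néron),
take its (R-L) conjunct `IndexLowerBoundAt W 3 K P`, and convert with x11b3-p7's
`imcLowerWaldspurgerOnTreeAt_of_controlOnTreeAt_of_indexLowerBoundAt_prime` (`Ш(E/K)` finite by
Gross–Zagier + Kolyvagin). PUBLISHED binders `hGZ`, `hKo`, `hmod`. CONDITIONAL on `hCTL`.
[cite: Castella2018, Thm. 2.3 (arXiv:1704.06608 p. 5) (shape only; nothing asserted)]
[cite: JetchevSkinnerWan2017, Thm. 3.3.1 and §7.4.1 (eq:shalowerK-1)] -/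
theorem cornerStepLAt_of_cornerSplitResidualAt_of_control [Fact (Nat.Prime 3)]
    (hGZ : ∀ (N : ℕ) [NeZero N] (W : WeierstrassCurve ℚ) (K : Type) [Field K] [NumberField K],
      gross_zagier N W K)
    (hKo : ∀ (N : ℕ) [NeZero N] (W : WeierstrassCurve ℚ) (K : Type) [Field K] [NumberField K],
      kolyvagin N W K)
    (hmod : hasEntireLFunction_rat)
    (W : WeierstrassCurve ℚ) [W.IsElliptic] [W.IsGloballyMinimal]
    (hs : W.HasSplitMultiplicativeReductionAtPrime 3)
    -- the control identity at the corner's odd Heegner data — SHAPE, labelled hypothesis (no source)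
    (hCTL : ∀ (N : ℕ) [NeZero N] (K : Type) [Field K] [NumberField K]
      (Dt : ModularParametrizationData W N) (H : HeegnerDatum N (NumberField.discr K)) (ι : K →+* ℂ)
      (P : (W.baseChange K).toAffine.Point),
      W.conductorNorm ℤ = N → IsImaginaryQuadratic K → SatisfiesHeegnerHypothesis N K →
      WeierstrassCurve.Affine.Point.map ι.toRatAlgHom P = heegnerPointComplex Dt H →
      ¬ IsOfFinAddOrder P →
      ∀ (κ : ZpExtension K 3), κ.IsAnticyclotomic →
        ∀ (γ : Field.absoluteGaloisGroup K) [Fact (κ.IsTopGenerator γ)]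
          (𝔭 : HeightOneSpectrum (𝓞 K)) (h𝔭 : ((3 : ℕ) : 𝓞 K) ∈ 𝔭.asIdeal)
          (he : 𝔭.asIdeal.ramificationIdx (𝓞 ℚ) = 1) (hf : 𝔭.asIdeal.inertiaDeg (𝓞 ℚ) = 1),
          ControlOnTreeAt 3 κ 𝔭 γ (embAt K 3 𝔭 h𝔭 he hf) P)
    (hR : CornerSplitResidualAt W) : CornerStepLAt W := by
  intro N _ K _ _ Dt H ι P hX hns hN hK hodd hHN hLt hP hc hPinf κ hκ γ _ 𝔭 h𝔭 he hf
  obtain ⟨hr, -, -, -⟩ := id hX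
  have hD0 : (NumberField.discr K : ℚ) ≠ 0 := by exact_mod_cast NumberField.discr_ne_zero K
  haveI hEt : (W.quadraticTwist (NumberField.discr K : ℚ)).IsElliptic :=
    W.isElliptic_quadraticTwist hD0
  obtain ⟨Cd, hCd⟩ := hasGlobalMinimalModel_rat_holds (W.quadraticTwist (NumberField.discr K : ℚ))
  haveI := hCd
  haveI hfinK : Finite (W.baseChange K).sha :=
    finite_sha_baseChange_of_heegner W N K Dt H ι P (hGZ N W K) (hKo N W K) hmod hr hK hHN hLt hP
  obtain ⟨hL, -, -⟩ := hR hX hns hs N K Dt H ι P (Cd • W.quadraticTwist (NumberField.discr K : ℚ)) Cd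
    hN hK hodd hHN hLt hP hc hPinf hfinK rfl
  exact imcLowerWaldspurgerOnTreeAt_of_controlOnTreeAt_of_indexLowerBoundAt_prime hK hN hHN
    (hCTL N K Dt H ι P hN hK hHN hP hPinf κ hκ γ 𝔭 h𝔭 he hf) hL

/-- **THE BRIDGE (lead deal #6 (R6-2)): on a split-corner pair, GIVEN THE CONTROL IDENTITY at its odd
Heegner data, the hull `CornerSplitResidualAt W` is EQUIVALENT to the three inputs of record
`CornerStepLAt W ∧ CornerTwistAt W ∧ CornerUpperAt W`**, modulo the PUBLISHED facts Gross–Zagier,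
Kolyvagin, GZK, modularity, newform, Mazur 1978 Cor. 4.1, Poitou–Tate, local Euler characteristic.
(⇐) is `cornerSplitResidualAt_of_cornerInputs` (no control needed); (⇒) is the three theorems above,
control entering ONLY for (L). Without `hCTL` the hull stays on the Gross–Zagier side of (L): it is a
hull for orientation and a substitute of record for (Tw) ∧ (U♯) only. CONDITIONAL; nothing booked.
[cite: Castella2018, Thm. 2.3 (shape only; nothing asserted)] [cite: GrossLMS1991, §2 Conj. (2.2)]
[cite: Miller2011LMS, Def. 1.1] -/
theorem cornerSplitResidualAt_iff_cornerInputs_of_control [Fact (Nat.Prime 3)]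
    (hGZ : ∀ (N : ℕ) [NeZero N] (W : WeierstrassCurve ℚ) (K : Type) [Field K] [NumberField K],
      gross_zagier N W K)
    (hKo : ∀ (N : ℕ) [NeZero N] (W : WeierstrassCurve ℚ) (K : Type) [Field K] [NumberField K],
      kolyvagin N W K)
    (hGZK : rank_eq_analyticRank_of_analyticRank_le_one) (hmod : hasEntireLFunction_rat)
    (hnf : exists_isNewformOf) (hMaz : mazur_not_dvd_maninConstant_of_odd)
    (hPT : ∀ (K : Type) [Field K] [NumberField K], poitouTate_sum_localTatePairing_eq_zero K)
    (hEP : ∀ (K : Type) [Field K] [NumberField K] (v : HeightOneSpectrum (𝓞 K)),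
      localEulerPoincareCharacteristic (v.adicCompletion K))
    (W : WeierstrassCurve ℚ) [W.IsElliptic] [W.IsGloballyMinimal]
    (hs : W.HasSplitMultiplicativeReductionAtPrime 3)
    (hCTL : ∀ (N : ℕ) [NeZero N] (K : Type) [Field K] [NumberField K]
      (Dt : ModularParametrizationData W N) (H : HeegnerDatum N (NumberField.discr K)) (ι : K →+* ℂ)
      (P : (W.baseChange K).toAffine.Point),
      W.conductorNorm ℤ = N → IsImaginaryQuadratic K → SatisfiesHeegnerHypothesis N K →
      WeierstrassCurve.Affine.Point.map ι.toRatAlgHom P = heegnerPointComplex Dt H →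
      ¬ IsOfFinAddOrder P →
      ∀ (κ : ZpExtension K 3), κ.IsAnticyclotomic →
        ∀ (γ : Field.absoluteGaloisGroup K) [Fact (κ.IsTopGenerator γ)]
          (𝔭 : HeightOneSpectrum (𝓞 K)) (h𝔭 : ((3 : ℕ) : 𝓞 K) ∈ 𝔭.asIdeal)
          (he : 𝔭.asIdeal.ramificationIdx (𝓞 ℚ) = 1) (hf : 𝔭.asIdeal.inertiaDeg (𝓞 ℚ) = 1),
          ControlOnTreeAt 3 κ 𝔭 γ (embAt K 3 𝔭 h𝔭 he hf) P) :
    CornerSplitResidualAt W ↔ CornerStepLAt W ∧ CornerTwistAt W ∧ CornerUpperAt W :=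
  ⟨fun hR ↦ ⟨cornerStepLAt_of_cornerSplitResidualAt_of_control hGZ hKo hmod W hs hCTL hR,
      cornerTwistAt_of_cornerSplitResidualAt hGZ hKo hGZK hmod hnf hMaz W hs hR,
      cornerUpperAt_of_cornerSplitResidualAt W hs hR⟩,
    fun ⟨hSL, hTw, hU⟩ ↦ cornerSplitResidualAt_of_cornerInputs hGZ hKo hGZK hmod hPT hEP W hSL hTw hU⟩

end Summit.BirchSwinnertonDyer.Rank1Residual.X11b.Three

end
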